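import Summits.HubbardSuperconductivity.HubbardSuperconductivity.Theorems.LevyLogBootstrapDressHalfFilledPairResolventCertificate
import HarnessLib

/-!
# Crux `DressHalfFilled` (stmt-HubbardSuperconductivity-8148, routes `LevyLogBootstrap` / `AnisotropyChord`), stub 1
# `stub_plaquetteData`, certificate (W1): the a-posteriori certificate for a FAMILY SUM of pair resolvents, and the
# column calculus of trial matrices

Support file (`--supports stmt-HubbardSuperconductivity-8148`), continuing `…PairResolventSylvester` /
`…PairResolventCertificate`. The second-order kernel entries of `plaquetteKernel U` are sums `Σ_{y',y} K(E; a_{y'}, b_y;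
c_{y'}, d_y)` of Kato's pair resolvent over the two boundary bonds (`…KernelTerms`); one trial matrix `Y ≈ Σ_y X(b_y, d_y)`
certifies the whole sum. For a Hermitian `H`, coordinate blocks `p₁, p₂` with form floors `θ₁, θ₂`, `E < θ₁ + θ₂`:

* `pairResolvent_family_certificate` — for families `a, c` (indexed by `ι'`) and `b, d` (indexed by `ι`) supported on
  `p₁` / `p₂` and ANY `Y` supported on `p₁ × p₂`,
  `(θ₁+θ₂-E) · |Σ_{k',k} K(a_{k'},b_k,c_{k'},d_k) - Σ_{k'} ⟨a_{k'} ⊗ c_{k'}, Y⟩| ≤ (Σ_{k'} ‖a_{k'}‖‖c_{k'}‖) · ‖Σ_k b_k d_kᵀ - (HY + YHᵀ - EY)‖_F`;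
* the COLUMN CALCULUS for trial matrices written as `Y = Σ_J y_J f_Jᵀ` over an orthonormal family `f_J` of the second
  block: the pairing `⟨a ⊗ c, Y⟩ = Σ_J ⟨a, y_J⟩ ⟨c, f_J⟩` (`pairing_sum_vecMulVec`), the Frobenius norm
  `‖Σ_J r_J f_Jᵀ‖_F² = Σ_J ‖r_J‖²` (`frobenius_sum_vecMulVec_orthonormal`), and the Sylvester image
  `H Y + Y Hᵀ - E Y = Σ_J (H y_J + Σ_{J'} h_{J J'} y_{J'} - E y_J) f_Jᵀ` when `H f_J = Σ_{J'} h_{J' J} f_{J'}`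
  (`sylvester_sum_vecMulVec`), so that a certificate reduces to inner products and `H`-images of explicit block vectors.

Sources: T. Kato, *Perturbation Theory for Linear Operators* (1966) I-§5.3; elementary residual linear algebra. No
definition and no named fact is introduced; sorry-free.
-/

noncomputable section

set_option linter.dupNamespace false

namespace Summit.HubbardSuperconductivity.HubbardSuperconductivity.Theorems.LevyLogBootstrap

open Matrix Finset Literature.MathematicalPhysics.QuantumLattice
open scoped ComplexOrder

section Generic

variable {m : Type*} [Fintype m] [DecidableEq m]

/-! ### The certificate for a family sum -/

/-- **The a-posteriori certificate for a family sum of pair resolvents.** Blocks `p₁, p₂` of `H` with form floors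
`θ₁, θ₂`, `E < θ₁ + θ₂`; `a_{k'}, b_k` supported on `p₁`, `c_{k'}, d_k` on `p₂`; `Y` supported on `p₁ × p₂`. Then
`(θ₁+θ₂-E) · |Σ_{k'} Σ_k K(E; a_{k'}, b_k; c_{k'}, d_k) - Σ_{k'} Σ_{ij} ā_{k' i} c̄_{k' j} Y_{ij}|
  ≤ (Σ_{k'} ‖a_{k'}‖ ‖c_{k'}‖) · ‖Σ_k b_k d_kᵀ - (H Y + Y Hᵀ - E Y)‖_F`. [folklore] -/
theorem pairResolvent_family_certificate {H : Matrix m m ℂ} (hH : H.IsHermitian) (p₁ p₂ : m → Prop)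
    [DecidablePred p₁] [DecidablePred p₂] (hK₁ : ∀ j k, ¬ p₁ j → p₁ k → H j k = 0)
    (hK₂ : ∀ j k, ¬ p₂ j → p₂ k → H j k = 0) {θ₁ θ₂ E : ℝ}
    (hθ₁ : ∀ u : m → ℂ, (∀ j, ¬ p₁ j → u j = 0) → θ₁ * (star u ⬝ᵥ u).re ≤ (star u ⬝ᵥ H *ᵥ u).re)
    (hθ₂ : ∀ u : m → ℂ, (∀ j, ¬ p₂ j → u j = 0) → θ₂ * (star u ⬝ᵥ u).re ≤ (star u ⬝ᵥ H *ᵥ u).re)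
    (hE : E < θ₁ + θ₂) {ι' ι : Type*} [Fintype ι'] [Fintype ι]
    {a c : ι' → m → ℂ} {b d : ι → m → ℂ}
    (ha : ∀ k j, ¬ p₁ j → a k j = 0) (hb : ∀ k j, ¬ p₁ j → b k j = 0)
    (hc : ∀ k j, ¬ p₂ j → c k j = 0) (hd : ∀ k j, ¬ p₂ j → d k j = 0)
    {Y : Matrix m m ℂ} (hY : ∀ i j, ¬ (p₁ i ∧ p₂ j) → Y i j = 0) :
    (θ₁ + θ₂ - E) *
        ‖(∑ k', ∑ k, pairResolvent hH E (a k') (b k) (c k') (d k)) -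
          ∑ k', ∑ i, ∑ j, star (a k' i) * star (c k' j) * Y i j‖ ≤
      (∑ k', eucNorm (a k') * eucNorm (c k')) *
        eucNorm (fun ij : m × m => ((∑ k, vecMulVec (b k) (d k)) - (H * Y + Y * Hᵀ - (E : ℂ) • Y)) ij.1 ij.2) := by
  -- the exact solutions, one per `k`
  set X : ι → Matrix m m ℂ := fun k => ∑ μ, ∑ ν, ((((hH.eigenvalues μ + hH.eigenvalues ν - E : ℝ) : ℂ))⁻¹ *
      (star ⇑(hH.eigenvectorBasis μ) ⬝ᵥ b k) * (star ⇑(hH.eigenvectorBasis ν) ⬝ᵥ d k)) •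
    vecMulVec (fun j => if p₁ j then (⇑(hH.eigenvectorBasis μ) : m → ℂ) j else 0)
      (fun j => if p₂ j then (⇑(hH.eigenvectorBasis ν) : m → ℂ) j else 0) with hXdef
  have hPR : ∀ k' k, pairResolvent hH E (a k') (b k) (c k') (d k) =
      ∑ i, ∑ j, star (a k' i) * star (c k' j) * X k i j := fun k' k =>
    pairResolvent_eq_pairing_solution hH p₁ p₂ E (ha k') (b k) (hc k') (d k) (X k) rfl
  have hSyl : ∀ k, H * X k + X k * Hᵀ - (E : ℂ) • X k = vecMulVec (b k) (d k) := by
    intro k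
    have h := sylvester_pairingSolution hH p₁ p₂ hK₁ hK₂ hθ₁ hθ₂ hE (b k) (d k) (X k) rfl
    rwa [indicator_eq_self_of_support p₁ (hb k), indicator_eq_self_of_support p₂ (hd k)] at h
  have hXsupp : ∀ k i j, ¬ (p₁ i ∧ p₂ j) → X k i j = 0 := by
    intro k i j hij
    simp only [hXdef, Matrix.sum_apply, Matrix.smul_apply, vecMulVec_apply, smul_eq_mul]
    refine Finset.sum_eq_zero fun μ _ => Finset.sum_eq_zero fun ν _ => ?_
    by_cases hi : p₁ i
    · have hj : ¬ p₂ j := fun hj => hij ⟨hi, hj⟩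
      rw [if_neg hj, mul_zero, mul_zero]
    · rw [if_neg hi, zero_mul, mul_zero]
  -- the summed solution and its Sylvester image
  set Xs : Matrix m m ℂ := ∑ k, X k with hXs
  have hSylS : H * Xs + Xs * Hᵀ - (E : ℂ) • Xs = ∑ k, vecMulVec (b k) (d k) := by
    rw [hXs, Matrix.mul_sum, Finset.sum_mul, Finset.smul_sum, ← Finset.sum_add_distrib, ← Finset.sum_sub_distrib]
    exact Finset.sum_congr rfl fun k _ => hSyl k
  have hXsSupp : ∀ i j, ¬ (p₁ i ∧ p₂ j) → Xs i j = 0 := fun i j hij => by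
    rw [hXs, Matrix.sum_apply]
    exact Finset.sum_eq_zero fun k _ => hXsupp k i j hij
  -- the difference `D = Xs - Y`
  set D : Matrix m m ℂ := Xs - Y with hD
  have hDsupp : ∀ i j, ¬ (p₁ i ∧ p₂ j) → D i j = 0 := fun i j hij => by
    rw [hD, Matrix.sub_apply, hXsSupp i j hij, hY i j hij, sub_zero]
  have hDimg : H * D + D * Hᵀ - (E : ℂ) • D =
      (∑ k, vecMulVec (b k) (d k)) - (H * Y + Y * Hᵀ - (E : ℂ) • Y) := by
    rw [hD, ← hSylS, Matrix.mul_sub, Matrix.sub_mul, smul_sub]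
    abel
  -- the difference of the two sums is `Σ_{k'} ⟨a_{k'} ⊗ c_{k'}, D⟩`
  have hdiff : (∑ k', ∑ k, pairResolvent hH E (a k') (b k) (c k') (d k)) -
      ∑ k', ∑ i, ∑ j, star (a k' i) * star (c k' j) * Y i j =
      ∑ k', star (fun ij : m × m => a k' ij.1 * c k' ij.2) ⬝ᵥ (fun ij : m × m => D ij.1 ij.2) := by
    rw [← Finset.sum_sub_distrib]
    refine Finset.sum_congr rfl fun k' _ => ?_
    rw [← pairing_eq_dotProduct]
    simp only [hPR k']
    -- `Σ_k Σ_ij ā c̄ X_k = Σ_ij ā c̄ Xs`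
    have hsum : (∑ k, ∑ i, ∑ j, star (a k' i) * star (c k' j) * X k i j) =
        ∑ i, ∑ j, star (a k' i) * star (c k' j) * Xs i j := by
      rw [Finset.sum_comm]
      refine Finset.sum_congr rfl fun i _ => ?_
      rw [Finset.sum_comm]
      refine Finset.sum_congr rfl fun j _ => ?_
      rw [hXs, Matrix.sum_apply, Finset.mul_sum]
    rw [hsum, ← Finset.sum_sub_distrib]
    refine Finset.sum_congr rfl fun i _ => ?_
    rw [← Finset.sum_sub_distrib]
    refine Finset.sum_congr rfl fun j _ => ?_
    rw [hD, Matrix.sub_apply, mul_sub]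
  rw [hdiff]
  -- Cauchy–Schwarz termwise, coercivity for `‖D‖_F`
  have hg : 0 < θ₁ + θ₂ - E := by linarith
  have hco := sylvester_eucNorm_le p₁ p₂ hθ₁ hθ₂ hE hDsupp
  rw [hDimg] at hco
  have hterm : ∀ k', ‖star (fun ij : m × m => a k' ij.1 * c k' ij.2) ⬝ᵥ (fun ij : m × m => D ij.1 ij.2)‖ ≤
      eucNorm (a k') * eucNorm (c k') * eucNorm (fun ij : m × m => D ij.1 ij.2) := by
    intro k'
    have h := norm_star_dotProduct_le (fun ij : m × m => a k' ij.1 * c k' ij.2) (fun ij : m × m => D ij.1 ij.2)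
    rwa [eucNorm_tensor] at h
  have hsumle : ‖∑ k', star (fun ij : m × m => a k' ij.1 * c k' ij.2) ⬝ᵥ (fun ij : m × m => D ij.1 ij.2)‖ ≤
      (∑ k', eucNorm (a k') * eucNorm (c k')) * eucNorm (fun ij : m × m => D ij.1 ij.2) := by
    refine (norm_sum_le _ _).trans ?_
    rw [Finset.sum_mul]
    exact Finset.sum_le_sum fun k' _ => hterm k'
  have hS0 : 0 ≤ ∑ k', eucNorm (a k') * eucNorm (c k') :=
    Finset.sum_nonneg fun k' _ => mul_nonneg (eucNorm_nonneg _) (eucNorm_nonneg _)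
  calc (θ₁ + θ₂ - E) * ‖∑ k', star (fun ij : m × m => a k' ij.1 * c k' ij.2) ⬝ᵥ fun ij => D ij.1 ij.2‖
      ≤ (θ₁ + θ₂ - E) * ((∑ k', eucNorm (a k') * eucNorm (c k')) * eucNorm (fun ij : m × m => D ij.1 ij.2)) :=
        mul_le_mul_of_nonneg_left hsumle hg.le
    _ = (∑ k', eucNorm (a k') * eucNorm (c k')) * ((θ₁ + θ₂ - E) * eucNorm (fun ij : m × m => D ij.1 ij.2)) := by
        ring
    _ ≤ _ := mul_le_mul_of_nonneg_left hco hS0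

/-! ### Column calculus of trial matrices `Y = Σ_J y_J f_Jᵀ` -/

omit [DecidableEq m] in
/-- **The pairing with a column sum**: `Σ_{ij} ā_i c̄_j (Σ_J y_J f_Jᵀ)_{ij} = Σ_J ⟨a, y_J⟩ ⟨c, f_J⟩`. [folklore] -/
theorem pairing_sum_vecMulVec {κ : Type*} [Fintype κ] (a c : m → ℂ) (y f : κ → m → ℂ) :
    ∑ i, ∑ j, star (a i) * star (c j) * (∑ J, vecMulVec (y J) (f J)) i j =
      ∑ J, (star a ⬝ᵥ y J) * (star c ⬝ᵥ f J) := by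
  have hL : ∀ i j, star (a i) * star (c j) * (∑ J, vecMulVec (y J) (f J)) i j =
      ∑ J, (star (a i) * y J i) * (star (c j) * f J j) := by
    intro i j
    rw [Matrix.sum_apply, Finset.mul_sum]
    refine Finset.sum_congr rfl fun J _ => ?_
    rw [vecMulVec_apply]; ring
  have hR : ∀ J, (star a ⬝ᵥ y J) * (star c ⬝ᵥ f J) = ∑ i, ∑ j, (star (a i) * y J i) * (star (c j) * f J j) := by
    intro J
    simp only [dotProduct, Pi.star_apply]
    rw [Finset.sum_mul_sum]
  simp only [hL, hR]
  calc ∑ i, ∑ j, ∑ J, star (a i) * y J i * (star (c j) * f J j)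
      = ∑ i, ∑ J, ∑ j, star (a i) * y J i * (star (c j) * f J j) :=
        Finset.sum_congr rfl fun i _ => Finset.sum_comm
    _ = ∑ J, ∑ i, ∑ j, star (a i) * y J i * (star (c j) * f J j) := Finset.sum_comm

omit [DecidableEq m] in
/-- **Frobenius norm of a column sum over an orthonormal family**: if `⟨f_J, f_{J'}⟩ = δ_{JJ'}` then
`‖Σ_J r_J f_Jᵀ‖_F² = Σ_J ‖r_J‖²`. [folklore] -/
theorem frobenius_sum_vecMulVec_orthonormal {κ : Type*} [Fintype κ] [DecidableEq κ] (r f : κ → m → ℂ)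
    (hf : ∀ J J', star (f J) ⬝ᵥ f J' = if J = J' then 1 else 0) :
    eucNorm (fun ij : m × m => (∑ J, vecMulVec (r J) (f J)) ij.1 ij.2) ^ 2 = ∑ J, eucNorm (r J) ^ 2 := by
  have hff : ∀ J J', ∑ j, star (f J j) * f J' j = if J = J' then 1 else 0 := fun J J' => by
    rw [← hf J J', dotProduct]; rfl
  -- the complex identity `⟨Y, Y⟩_F = Σ_J ⟨r_J, r_J⟩`
  have key : star (fun ij : m × m => (∑ J, vecMulVec (r J) (f J)) ij.1 ij.2) ⬝ᵥ
      (fun ij : m × m => (∑ J, vecMulVec (r J) (f J)) ij.1 ij.2) = ∑ J, star (r J) ⬝ᵥ r J := by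
    rw [dotProduct, Fintype.sum_prod_type]
    simp only [Pi.star_apply, Matrix.sum_apply, vecMulVec_apply, star_sum, star_mul']
    -- expand the product of the two `J`-sums
    have hexp : ∀ i j, (∑ J, star (r J i) * star (f J j)) * (∑ J', r J' i * f J' j) =
        ∑ J, ∑ J', (star (r J i) * r J' i) * (star (f J j) * f J' j) := by
      intro i j
      rw [Finset.sum_mul_sum]
      exact Finset.sum_congr rfl fun J _ => Finset.sum_congr rfl fun J' _ => by ring
    simp only [hexp]
    -- sum over `j` first, using orthonormality
    calc ∑ i, ∑ j, ∑ J, ∑ J', star (r J i) * r J' i * (star (f J j) * f J' j)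
        = ∑ i, ∑ J, ∑ J', ∑ j, star (r J i) * r J' i * (star (f J j) * f J' j) := by
          refine Finset.sum_congr rfl fun i _ => ?_
          rw [Finset.sum_comm]
          exact Finset.sum_congr rfl fun J _ => Finset.sum_comm
      _ = ∑ i, ∑ J, ∑ J', star (r J i) * r J' i * (if J = J' then 1 else 0) := by
          refine Finset.sum_congr rfl fun i _ => Finset.sum_congr rfl fun J _ =>
            Finset.sum_congr rfl fun J' _ => ?_
          rw [← Finset.mul_sum, hff]
      _ = ∑ i, ∑ J, star (r J i) * r J i := by
          refine Finset.sum_congr rfl fun i _ => Finset.sum_congr rfl fun J _ => ?_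
          simp only [mul_ite, mul_one, mul_zero, Finset.sum_ite_eq, Finset.mem_univ, if_true]
      _ = ∑ J, star (r J) ⬝ᵥ r J := by
          rw [Finset.sum_comm]
          exact Finset.sum_congr rfl fun J _ => by rw [dotProduct]; rfl
  rw [eucNorm_sq, key, Complex.re_sum]
  exact Finset.sum_congr rfl fun J _ => (eucNorm_sq (r J)).symm

omit [Fintype m] [DecidableEq m] in
/-- `vecMulVec` is additive in the first argument under a finite sum. [folklore] -/
theorem sum_vecMulVec_left {κ : Type*} (s : Finset κ) (u : κ → m → ℂ) (v : m → ℂ) :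
    ∑ J ∈ s, vecMulVec (u J) v = vecMulVec (∑ J ∈ s, u J) v := by
  ext i j
  simp only [Matrix.sum_apply, vecMulVec_apply, Finset.sum_apply, Finset.sum_mul]

omit [DecidableEq m] in
/-- **The Sylvester image of a column sum.** If `H f_J = Σ_{J'} h_{J' J} f_{J'}` (the second block is invariant, with
matrix `h` in the family `f`), then
`H (Σ_J y_J f_Jᵀ) + (Σ_J y_J f_Jᵀ) Hᵀ - E Σ_J y_J f_Jᵀ = Σ_J (H y_J + Σ_{J'} h_{J J'} y_{J'} - E y_J) f_Jᵀ`. [folklore] -/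
theorem sylvester_sum_vecMulVec {κ : Type*} [Fintype κ] (H : Matrix m m ℂ) (E : ℂ) (y f : κ → m → ℂ)
    (h : κ → κ → ℂ) (hf : ∀ J, H *ᵥ f J = ∑ J', h J' J • f J') :
    H * (∑ J, vecMulVec (y J) (f J)) + (∑ J, vecMulVec (y J) (f J)) * Hᵀ - E • ∑ J, vecMulVec (y J) (f J) =
      ∑ J, vecMulVec (H *ᵥ y J + (∑ J', h J J' • y J') - E • y J) (f J) := by
  -- the three pieces
  have h1 : H * (∑ J, vecMulVec (y J) (f J)) = ∑ J, vecMulVec (H *ᵥ y J) (f J) := by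
    rw [Matrix.mul_sum]
    exact Finset.sum_congr rfl fun J _ => mul_vecMulVec _ _ _
  have h2 : (∑ J, vecMulVec (y J) (f J)) * Hᵀ = ∑ J, vecMulVec (∑ J', h J J' • y J') (f J) := by
    rw [Finset.sum_mul]
    have step : ∀ J, vecMulVec (y J) (f J) * Hᵀ = ∑ J', vecMulVec (h J' J • y J) (f J') := by
      intro J
      rw [vecMulVec_mul, vecMul_transpose, hf J]
      ext i j
      simp only [vecMulVec_apply, Finset.sum_apply, Pi.smul_apply, smul_eq_mul, Matrix.sum_apply, Finset.mul_sum]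
      exact Finset.sum_congr rfl fun J' _ => by ring
    simp only [step]
    rw [Finset.sum_comm]
    refine Finset.sum_congr rfl fun J' _ => ?_
    rw [sum_vecMulVec_left]
  have h3 : E • ∑ J, vecMulVec (y J) (f J) = ∑ J, vecMulVec (E • y J) (f J) := by
    rw [Finset.smul_sum]
    exact Finset.sum_congr rfl fun J _ => (smul_vecMulVec _ _ _).symm
  rw [h1, h2, h3, ← Finset.sum_add_distrib, ← Finset.sum_sub_distrib]
  refine Finset.sum_congr rfl fun J _ => ?_
  rw [← add_vecMulVec, ← sub_vecMulVec]

omit [Fintype m] [DecidableEq m] in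
/-- A rank-one family `Σ_k b_k d_kᵀ` with `d_k = Σ_J δ_{k J} f_J` is the column sum `Σ_J (Σ_k δ_{k J} b_k) f_Jᵀ`. [folklore] -/
theorem sum_vecMulVec_expand {κ ι : Type*} [Fintype κ] [Fintype ι] (b d : ι → m → ℂ) (f : κ → m → ℂ)
    (δ : ι → κ → ℂ) (hd : ∀ k, d k = ∑ J, δ k J • f J) :
    ∑ k, vecMulVec (b k) (d k) = ∑ J, vecMulVec (∑ k, δ k J • b k) (f J) := by
  have step : ∀ k, vecMulVec (b k) (d k) = ∑ J, vecMulVec (δ k J • b k) (f J) := by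
    intro k
    rw [hd k]
    ext i j
    simp only [vecMulVec_apply, Finset.sum_apply, Pi.smul_apply, smul_eq_mul, Matrix.sum_apply, Finset.mul_sum]
    exact Finset.sum_congr rfl fun J _ => by ring
  simp only [step]
  rw [Finset.sum_comm]
  exact Finset.sum_congr rfl fun J _ => sum_vecMulVec_left _ _ _

omit [Fintype m] [DecidableEq m] in
/-- Difference of two column sums over the same family. [folklore] -/
theorem sum_vecMulVec_sub {κ : Type*} [Fintype κ] (u v f : κ → m → ℂ) :
    (∑ J, vecMulVec (u J) (f J)) - ∑ J, vecMulVec (v J) (f J) = ∑ J, vecMulVec (u J - v J) (f J) := by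
  rw [← Finset.sum_sub_distrib]
  exact Finset.sum_congr rfl fun J _ => (sub_vecMulVec _ _ _).symm

omit [Fintype m] [DecidableEq m] in
/-- Support of a column sum: if every `y_J` is supported on `p₁` and every `f_J` on `p₂`, then `Σ_J y_J f_Jᵀ` is
supported on `p₁ × p₂`. [folklore] -/
theorem sum_vecMulVec_support {κ : Type*} [Fintype κ] (p₁ p₂ : m → Prop) (y f : κ → m → ℂ)
    (hy : ∀ J j, ¬ p₁ j → y J j = 0) (hf : ∀ J j, ¬ p₂ j → f J j = 0) :
    ∀ i j, ¬ (p₁ i ∧ p₂ j) → (∑ J, vecMulVec (y J) (f J)) i j = 0 := by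
  intro i j hij
  rw [Matrix.sum_apply]
  refine Finset.sum_eq_zero fun J _ => ?_
  rw [vecMulVec_apply]
  by_cases hi : p₁ i
  · rw [hf J j (fun hj => hij ⟨hi, hj⟩), mul_zero]
  · rw [hy J i hi, zero_mul]

end Generic

end Summit.HubbardSuperconductivity.HubbardSuperconductivity.Theorems.LevyLogBootstrap

end
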